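import Mathlib
import Summits.ValiantsHypothesis.ValiantsHypothesis.Theorems.LacunarySymmetroidMatrixDescartesTieLawCount
import HarnessLib

/-!
# ValiantsHypothesis / LacunarySymmetroid — crux `MatrixDescartes` (stmt-ValiantsHypothesis-18050, V1), LINE (A) «product_plus_one»:
# the TIE LAW, kernel path Stage 2, part 5b — degrees, the splitting identity, the base case, location of the roots of `M_F`

Degrees and top coefficients of `n`, `q`, `M_F` (all positive for positive data), `M_F(0) < 0`, the SPLITTING IDENTITY
`M_{F ∪ {f₀}} = q_{f₀} · M_F + w_{f₀} · n_{f₀} · ∏_{f ∈ F} q_f` (pen §45.3), the base case `#{roots of w·n in S′} = 1`, and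
`roots_MF_subset`: with pairwise distinct positive roots `σ_f` every complex root of `M_F` lies in `S′ ∪ E` (boundary lemma +
`M_F(0) ≠ 0`).  HONEST FRAMING: helper lemmas; no stub of LINE (A) is touched; `MatrixDescartes` OPEN; `VP ≠ VNP` is NOT proved.
No definitions, no named facts.
-/

set_option linter.dupNamespace false

namespace Summit.ValiantsHypothesis.ValiantsHypothesis.Theorems.LacunarySymmetroidMatrixDescartes

namespace TieLaw

open Polynomial Filter Topology

section Count

variable {a b c : ℕ} {β γ : ℝ}

/-! ### Degrees and top coefficients -/

/-- A product of polynomials of degree `≤ n` over `s` has degree `≤ |s|·n`. -/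
theorem natDegree_prod_le_of_le {ι : Type*} (s : Finset ι) (f : ι → ℝ[X]) (n : ℕ)
    (h : ∀ i ∈ s, (f i).natDegree ≤ n) : (∏ i ∈ s, f i).natDegree ≤ s.card * n := by
  refine (natDegree_prod_le s f).trans ?_
  have := Finset.sum_le_card_nsmul s (fun i => (f i).natDegree) n h
  simpa using this

/-- `deg n ≤ c`. -/
theorem natDegree_nPoly_le (a b c : ℕ) (β γ : ℝ) : (nPoly a b c β γ).natDegree ≤ c := by
  unfold nPoly
  refine (natDegree_sub_le _ _).trans (max_le ?_ ?_)
  · exact (natDegree_C_mul_le _ _).trans (natDegree_X_pow_le _)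
  · exact (natDegree_C _).le.trans (Nat.zero_le _)

/-- The `c`-th coefficient of `n` is `bγ` (`c ≠ 0`). -/
theorem coeff_nPoly_top (hc : c ≠ 0) (a b : ℕ) (β γ : ℝ) : (nPoly a b c β γ).coeff c = b * γ := by
  rw [nPoly, coeff_sub, coeff_C_mul, coeff_X_pow, if_pos rfl, coeff_C, if_neg hc, mul_one, sub_zero]

/-- `deg m ≤ c`. -/
theorem natDegree_mPoly_le (c : ℕ) (β γ : ℝ) : (mPoly c β γ).natDegree ≤ c := by
  unfold mPoly
  refine (natDegree_add_le _ _).trans (max_le ?_ ?_)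
  · exact (natDegree_C _).le.trans (Nat.zero_le _)
  · exact (natDegree_C_mul_le _ _).trans (natDegree_X_pow_le _)

/-- `deg q ≤ 2c` (`a < c`). -/
theorem natDegree_qPoly_le (hac : a < c) (β γ : ℝ) : (qPoly a c β γ).natDegree ≤ 2 * c := by
  unfold qPoly
  have hm := natDegree_mPoly_le c β γ
  refine (natDegree_add_le _ _).trans (max_le ((natDegree_sub_le _ _).trans (max_le ?_ ?_)) ?_)
  · exact (natDegree_pow_le).trans (by nlinarith)
  · refine (natDegree_mul_le).trans ?_
    have := (natDegree_mul_le (p := C (2 * Real.cos (Real.pi * a / c))) (q := X ^ a)).trans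
      (add_le_add (natDegree_C _).le (natDegree_X_pow_le (R := ℝ) a))
    omega
  · exact (natDegree_X_pow_le _).trans (by omega)

/-- The `2c`-th coefficient of `q` is `γ²` (`a < c`). -/
theorem coeff_qPoly_top (hac : a < c) (β γ : ℝ) : (qPoly a c β γ).coeff (2 * c) = γ ^ 2 := by
  have hc : c ≠ 0 := by omega
  have hm : (mPoly c β γ).coeff c = γ := by simp [mPoly, coeff_add, coeff_C_mul, coeff_X_pow, coeff_C, hc]
  have h1 : (mPoly c β γ ^ 2).coeff (2 * c) = γ ^ 2 := by
    rw [pow_two, pow_two, show 2 * c = c + c by ring, coeff_mul_add_eq_of_natDegree_le (natDegree_mPoly_le c β γ)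
      (natDegree_mPoly_le c β γ), hm]
  have h2 : (C (2 * Real.cos (Real.pi * a / c)) * X ^ a * mPoly c β γ).coeff (2 * c) = 0 := by
    apply coeff_eq_zero_of_natDegree_lt
    calc (C (2 * Real.cos (Real.pi * a / c)) * X ^ a * mPoly c β γ).natDegree
        ≤ (C (2 * Real.cos (Real.pi * a / c)) * X ^ a).natDegree + (mPoly c β γ).natDegree := natDegree_mul_le
      _ ≤ a + c := add_le_add ((natDegree_C_mul_le _ _).trans (natDegree_X_pow_le _)) (natDegree_mPoly_le c β γ)
      _ < 2 * c := by omega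
  have h3 : ((X : ℝ[X]) ^ (2 * a)).coeff (2 * c) = 0 := by
    rw [coeff_X_pow, if_neg (by omega)]
  unfold qPoly
  rw [coeff_add, coeff_sub, h1, h2, h3]
  ring

/-- `deg M_F ≤ c(2|F| − 1)`. -/
theorem natDegree_MF_le {ι : Type*} [DecidableEq ι] (hab : a < b) (F : Finset ι) (β γ w : ι → ℝ) :
    (MF a b F β γ w).natDegree ≤ (a + b) * (2 * F.card - 1) := by
  unfold MF
  refine natDegree_sum_le_of_forall_le _ _ fun f hf => ?_
  have hcard : (F.erase f).card = F.card - 1 := Finset.card_erase_of_mem hf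
  have hpos : 0 < F.card := Finset.card_pos.2 ⟨f, hf⟩
  calc (C (w f) * nPoly a b (a + b) (β f) (γ f) * ∏ f' ∈ F.erase f, qPoly a (a + b) (β f') (γ f')).natDegree
      ≤ (C (w f) * nPoly a b (a + b) (β f) (γ f)).natDegree +
          (∏ f' ∈ F.erase f, qPoly a (a + b) (β f') (γ f')).natDegree := natDegree_mul_le
    _ ≤ (a + b) + (F.erase f).card * (2 * (a + b)) := by
        refine add_le_add ((natDegree_C_mul_le _ _).trans (natDegree_nPoly_le _ _ _ _ _)) ?_
        exact natDegree_prod_le_of_le _ _ _ fun f' _ => natDegree_qPoly_le (by omega) _ _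
    _ = (a + b) * (2 * F.card - 1) := by
        rw [hcard]
        rcases Nat.exists_eq_succ_of_ne_zero hpos.ne' with ⟨k, hk⟩
        rw [hk, Nat.succ_sub_one, show 2 * k.succ - 1 = 2 * k + 1 by omega]
        ring

/-- The top coefficient of `M_F`: `b Σ_f w_f γ_f ∏_{f' ≠ f} γ_{f'}²`. -/
theorem coeff_MF_top {ι : Type*} [DecidableEq ι] (hab : a < b) (F : Finset ι) (β γ w : ι → ℝ) :
    (MF a b F β γ w).coeff ((a + b) * (2 * F.card - 1)) =
      ∑ f ∈ F, w f * (b * γ f) * ∏ f' ∈ F.erase f, γ f' ^ 2 := by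
  have hc : a + b ≠ 0 := by omega
  unfold MF
  rw [finsetSum_coeff]
  refine Finset.sum_congr rfl fun f hf => ?_
  have hcard : (F.erase f).card = F.card - 1 := Finset.card_erase_of_mem hf
  have hpos : 0 < F.card := Finset.card_pos.2 ⟨f, hf⟩
  have hsplit : (a + b) * (2 * F.card - 1) = (a + b) + (F.erase f).card * (2 * (a + b)) := by
    rw [hcard]
    rcases Nat.exists_eq_succ_of_ne_zero hpos.ne' with ⟨k, hk⟩
    rw [hk, Nat.succ_sub_one, show 2 * k.succ - 1 = 2 * k + 1 by omega]
    ring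
  rw [hsplit, coeff_mul_add_eq_of_natDegree_le ((natDegree_C_mul_le _ _).trans (natDegree_nPoly_le _ _ _ _ _))
    (natDegree_prod_le_of_le _ _ _ fun f' _ => natDegree_qPoly_le (by omega) _ _),
    coeff_C_mul, coeff_nPoly_top hc, coeff_prod_of_natDegree_le _ _ _ (fun f' _ => natDegree_qPoly_le (by omega) _ _)]
  congr 1
  exact Finset.prod_congr rfl fun f' _ => coeff_qPoly_top (by omega) _ _

/-- The top coefficient of `M_F` is positive for positive data. -/
theorem coeff_MF_top_pos {ι : Type*} [DecidableEq ι] (hab : a < b) (F : Finset ι) (hF : F.Nonempty) (β γ w : ι → ℝ)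
    (hγ : ∀ f ∈ F, 0 < γ f) (hw : ∀ f ∈ F, 0 < w f) :
    0 < (MF a b F β γ w).coeff ((a + b) * (2 * F.card - 1)) := by
  rw [coeff_MF_top hab F]
  have hb : (0 : ℝ) < b := by exact_mod_cast (show 0 < b by omega)
  refine Finset.sum_pos (fun f hf => ?_) hF
  have := hw f hf
  have := hγ f hf
  have : 0 < ∏ f' ∈ F.erase f, γ f' ^ 2 :=
    Finset.prod_pos fun f' hf' => pow_pos (hγ f' (Finset.mem_of_mem_erase hf')) 2
  positivity

/-- `M_F(0) = −a Σ_f w_f β_f ∏_{f'≠f} β_{f'}² < 0` for positive data. -/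
theorem MF_eval_zero_neg {ι : Type*} [DecidableEq ι] (ha : 0 < a) (F : Finset ι) (hF : F.Nonempty)
    (β γ w : ι → ℝ) (hβ : ∀ f ∈ F, 0 < β f) (hw : ∀ f ∈ F, 0 < w f) :
    (MF a b F β γ w).eval 0 < 0 := by
  have ha' : (0 : ℝ) < a := by exact_mod_cast ha
  have hc : a + b ≠ 0 := by omega
  unfold MF
  rw [eval_finsetSum]
  refine Finset.sum_neg (fun f hf => ?_) hF
  have hn : (nPoly a b (a + b) (β f) (γ f)).eval 0 = -(a * β f) := by
    simp only [nPoly, eval_sub, eval_mul, eval_pow, eval_C, eval_X, zero_pow hc, mul_zero, zero_sub]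
  have hq : ∀ f' ∈ F.erase f, (qPoly a (a + b) (β f') (γ f')).eval 0 = β f' ^ 2 := fun f' _ => by
    simp only [qPoly, mPoly, eval_add, eval_sub, eval_mul, eval_pow, eval_C, eval_X, zero_pow hc, zero_pow ha.ne',
      zero_pow (show 2 * a ≠ 0 by omega), mul_zero, add_zero, zero_mul, sub_zero]
  rw [eval_mul, eval_mul, eval_C, hn, eval_prod, Finset.prod_congr rfl hq]
  have := hw f hf
  have := hβ f hf
  have : 0 < ∏ f' ∈ F.erase f, β f' ^ 2 :=
    Finset.prod_pos fun f' hf' => pow_pos (hβ f' (Finset.mem_of_mem_erase hf')) 2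
  nlinarith [mul_pos (mul_pos this (hw f hf)) (mul_pos ha' (hβ f hf))]

/-- Changing the weights off `F` does not change `M_F`. -/
theorem MF_congr_weights {ι : Type*} [DecidableEq ι] (a b : ℕ) (F : Finset ι) (β γ w w' : ι → ℝ)
    (h : ∀ f ∈ F, w f = w' f) : MF a b F β γ w = MF a b F β γ w' := by
  unfold MF
  exact Finset.sum_congr rfl fun f hf => by rw [h f hf]

/-- **Splitting identity** (pen §45.3): `M_{F ∪ {f₀}} = q_{f₀} · M_F + w_{f₀} · n_{f₀} · ∏_{f ∈ F} q_f` (`f₀ ∉ F`). -/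
theorem MF_cons {ι : Type*} [DecidableEq ι] (a b : ℕ) {F : Finset ι} {f₀ : ι} (hf₀ : f₀ ∉ F) (β γ w : ι → ℝ) :
    MF a b (Finset.cons f₀ F hf₀) β γ w =
      qPoly a (a + b) (β f₀) (γ f₀) * MF a b F β γ w +
        C (w f₀) * nPoly a b (a + b) (β f₀) (γ f₀) * ∏ f ∈ F, qPoly a (a + b) (β f) (γ f) := by
  unfold MF
  rw [Finset.sum_cons, add_comm]
  congr 1
  · rw [Finset.mul_sum]
    refine Finset.sum_congr rfl fun f hf => ?_
    have hne : f ≠ f₀ := fun h => hf₀ (h ▸ hf)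
    rw [Finset.erase_cons_of_ne _ hne.symm, Finset.prod_cons]
    ring
  · rw [Finset.erase_cons]

/-! ### Base case and the location of the roots of `M_F` -/

open Classical in
/-- **Base case**: `w · n` has exactly one root in `S′` (the positive `c`-th root of `aβ/(bγ)`). -/
theorem card_roots_single_tieSector (ha : 0 < a) (hab : a < b) (hβ : 0 < β) (hγ : 0 < γ) {w : ℝ} (hw : 0 < w) :
    (((C w * nPoly a b (a + b) β γ).map (algebraMap ℝ ℂ)).roots.filter (· ∈ tieSector (a + b))).card = 1 := by
  set c := a + b with hc
  have hc2 : 2 < c := by omega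
  have hc0 : 0 < c := by omega
  have hsin : 0 < Real.sin (Real.pi / c) := by
    apply Real.sin_pos_of_pos_of_lt_pi (by positivity)
    rw [div_lt_iff₀ (by exact_mod_cast hc0)]
    have : (1 : ℝ) < c := by exact_mod_cast (show 1 < c by omega)
    nlinarith [Real.pi_pos]
  -- roots of n = c-th roots of aβ/(bγ)
  have hb : (0 : ℝ) < b := by exact_mod_cast (show 0 < b by omega)
  have ha' : (0 : ℝ) < a := by exact_mod_cast ha
  obtain ⟨r, hr0, -, hroots⟩ := gFamC_roots_zero (β := a * β) (γ := b * γ) a hc0 (by positivity) (by positivity)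
  have hmap : (C w * nPoly a b c β γ).map (algebraMap ℝ ℂ) =
      C (w : ℂ) * ((C ((b * γ : ℝ) : ℂ) * X ^ c - C ((a * β : ℝ) : ℂ)) + C ((0 : ℝ) : ℂ) * X ^ a) := by
    simp only [nPoly, Polynomial.map_mul, Polynomial.map_sub, Polynomial.map_pow, map_C, map_X, Complex.coe_algebraMap]
    push_cast
    simp only [map_zero, zero_mul, add_zero]
  rw [hmap, roots_C_mul _ (by exact_mod_cast hw.ne'), hroots, Multiset.filter_map, Multiset.card_map]
  set ζ := rot (2 * Real.pi / c) with hζ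
  have hζprim : IsPrimitiveRoot ζ c := isPrimitiveRoot_rot c hc0.ne'
  -- only k = 0 lands in S′
  have hiff : ∀ k ∈ Multiset.range c, ((fun x => x ∈ tieSector c) ∘ fun k => ζ ^ k * (r : ℂ)) k ↔ k = 0 := by
    intro k hk
    rw [Multiset.mem_range] at hk
    simp only [Function.comp, mem_tieSector, hζ, ← rot_nat_mul]
    rw [mul_comm (rot _) (r : ℂ), mul_assoc, mul_assoc, ← rot_add, ← rot_add, im_ofReal_mul_rot, im_ofReal_mul_rot,
      show (k : ℝ) * (2 * Real.pi / c) + Real.pi / c = (2 * k + 1) * Real.pi / c by ring,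
      show (k : ℝ) * (2 * Real.pi / c) + -(Real.pi / c) = (2 * k - 1) * Real.pi / c by ring]
    constructor
    · rintro ⟨h1, h2⟩
      by_contra hk0
      have hk1 : (1 : ℝ) ≤ k := by exact_mod_cast Nat.one_le_iff_ne_zero.2 hk0
      have hkc : (k : ℝ) ≤ c - 1 := by
        have : k ≤ c - 1 := by omega
        have h' : ((c - 1 : ℕ) : ℝ) = (c : ℝ) - 1 := by rw [Nat.cast_sub (by omega)]; simp
        rw [← h']; exact_mod_cast this
      have hcpos : (0 : ℝ) < c := by exact_mod_cast hc0
      have s1 : 0 < Real.sin ((2 * k + 1) * Real.pi / c) := by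
        have := mul_pos_iff.1 (show 0 < r * Real.sin ((2 * k + 1) * Real.pi / c) from h1)
        rcases this with ⟨_, h⟩ | ⟨h, _⟩
        · exact h
        · linarith
      have s2 : Real.sin ((2 * k - 1) * Real.pi / c) < 0 := by
        rcases (mul_neg_iff.1 (show r * Real.sin ((2 * k - 1) * Real.pi / c) < 0 from h2)) with ⟨_, h⟩ | ⟨h, _⟩
        · exact h
        · linarith
      -- s1 forces (2k+1) < c, s2 forces (2k-1) > c: contradiction
      have t1 : (2 * k + 1 : ℝ) < c := by
        by_contra hge
        push Not at hge
        have hx : Real.pi ≤ (2 * k + 1) * Real.pi / c := by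
          rw [le_div_iff₀ hcpos]; nlinarith [Real.pi_pos]
        have hx2 : (2 * k + 1) * Real.pi / c < 2 * Real.pi := by
          rw [div_lt_iff₀ hcpos]; nlinarith [Real.pi_pos]
        have := Real.sin_nonpos_of_nonpos_of_neg_pi_le (x := (2 * k + 1) * Real.pi / c - 2 * Real.pi)
          (by linarith) (by linarith)
        rw [Real.sin_sub_two_pi] at this
        linarith
      have t2 : (c : ℝ) < 2 * k - 1 := by
        by_contra hge
        push Not at hge
        have hx : 0 ≤ (2 * k - 1) * Real.pi / c := by
          apply div_nonneg _ hcpos.le; nlinarith [Real.pi_pos]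
        have hx2 : (2 * k - 1) * Real.pi / c ≤ Real.pi := by
          rw [div_le_iff₀ hcpos]; nlinarith [Real.pi_pos]
        have := Real.sin_nonneg_of_nonneg_of_le_pi hx hx2
        linarith
      linarith
    · intro hk0
      subst hk0
      simp only [Nat.cast_zero, mul_zero, zero_add, zero_sub, neg_mul, one_mul, neg_div, Real.sin_neg]
      exact ⟨mul_pos hr0 hsin, by nlinarith⟩
  rw [Multiset.filter_congr hiff, Multiset.filter_eq', Multiset.card_replicate]
  exact Multiset.count_eq_one_of_mem (Multiset.nodup_range c) (Multiset.mem_range.2 hc0)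

/-- **All roots of `M_F` lie in `S′ ∪ E`** for positive data with pairwise distinct positive roots `σ_f`
(the boundary lemma plus `M_F(0) ≠ 0`). -/
theorem roots_MF_subset {ι : Type*} [DecidableEq ι] (ha : 0 < a) (hab : a < b) (F : Finset ι) (hF : F.Nonempty)
    (β γ w σ : ι → ℝ) (hβ : ∀ f ∈ F, 0 < β f) (hγ : ∀ f ∈ F, 0 < γ f) (hw : ∀ f ∈ F, 0 < w f)
    (hσ : ∀ f ∈ F, 0 < σ f) (hroot : ∀ f ∈ F, (gPoly a (a + b) (β f) (γ f)).eval (σ f) = 0) (hinj : Set.InjOn σ F) :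
    ∀ z ∈ ((MF a b F β γ w).map (algebraMap ℝ ℂ)).roots, z ∈ tieSector (a + b) ∪ tieExterior (a + b) := by
  intro z hz
  have hneg := MF_eval_zero_neg (b := b) ha F hF β γ w hβ hw
  have hMne : MF a b F β γ w ≠ 0 := fun h => by
    rw [h, eval_zero] at hneg
    exact lt_irrefl _ hneg
  have hM0 : (MF a b F β γ w).map (algebraMap ℝ ℂ) ≠ 0 :=
    (Polynomial.map_ne_zero_iff (algebraMap ℝ ℂ).injective).2 hMne
  have hroot0 := (mem_roots hM0).1 hz
  by_contra hnot
  rw [Set.mem_union, not_or] at hnot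
  have hz0 : z ≠ 0 := by
    rintro rfl
    rw [IsRoot.def, eval_map, show (0 : ℂ) = algebraMap ℝ ℂ 0 from (map_zero _).symm, eval₂_at_apply] at hroot0
    have h00 := (algebraMap ℝ ℂ).injective hroot0
    rw [h00] at hneg
    exact lt_irrefl _ hneg
  obtain ⟨t, ht, hzt | hzt⟩ := eq_ray_of_not_mem_tie (by omega) hnot.1 hnot.2 hz0
  · exact MF_eval_upper_ray_ne_zero ha hab F hF β γ w σ hβ hγ hw hσ hroot hinj ht (by rw [← hzt]; exact hroot0)
  · exact MF_eval_lower_ray_ne_zero ha hab F hF β γ w σ hβ hγ hw hσ hroot hinj ht (by rw [← hzt]; exact hroot0)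

end Count

end TieLaw

end Summit.ValiantsHypothesis.ValiantsHypothesis.Theorems.LacunarySymmetroidMatrixDescartes
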